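import Literature.AnabelianGeometry.EtaleTheta.LogDivisorModelGaloisAction
import Literature.AnabelianGeometry.EtaleTheta.Discharge.Sec3Prop34iDivPlus
import Literature.AlgebraicGeometry.Frobenioids.PiNatFixedPoints
import HarnessLib

/-!
# [EtTh] Prop. 3.4 (i) for the CONSTRUCTED pieces `Φ₀(S) = Hom_G(S, Div⁺(Z^log_∞))` of Def. 3.3 (iii): weakly
# perf-factorial with cofinal perfection, for every `G`-set `S` (abc-iut-w6-d058's `LogDivisorModel.GaloisAction.phiZero`)

Mochizuki, *The étale theta function and its Frobenioid-theoretic manifestations*, Publ. RIMS **45** (2009), §3,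
Def. 3.3 (iii) PDF p. 73 (`Φ₀(Y^log) := lim Div⁺(Z^log_∞)^{Gal(Z^log_∞/Y^log)}`), Prop. 3.4 (i) p. 74 ("`Φ₀(Y^log)`, as
well as each of the monoids `Div⁺(Z^log_∞)^{Gal(Z^log_∞/Y^log)}` appearing in the inductive limit defining `Φ₀(Y^log)`,
is perf-factorial"; proof: "follows immediately from Proposition 3.2, (i)"), Rmk. 3.3.1 p. 73
[cite: MochizukiEtTh2009, Prop 3.4 p.74].

abc-iut cell, block C / W6 cone prover abc-iut-w6-d057, row **EtTh:Prop3.4(i)**, sequel at GENUINE DATA: abc-iut-w6-d058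
(row EtTh:Prop3.4(ii)) constructs, for a `LogDivisorModel` `Z` with a Galois-action record `A : Z.GaloisAction G`
(`LogDivisorModelGaloisAction.lean`), the Def. 3.3 (iii) monoids `A.phiZero S = Hom_G(S, Div⁺(Z^log_∞))` for every
`G`-set `S` (= `Div⁺(Z^log_∞)^H` at `S = G/H`) and shows that the typed `DivisorMonoids.Prop34` AT THIS DATA reduces to
its Prop. 3.4 (i) clauses (`prop34_ofGaloisAction_iff`).  THIS PROOF-ONLY FILE (theorems only) discharges the FIRST
of those clauses in the weak vocabulary of record, for every `S`:

* **`LogDivisorModel.GaloisAction.isPerfFactorialCof_phiZero`** / **`prop34_i_phiZero : treeMonoidVocabWeak.IsPerfFactorial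
  ↥(A.phiZero S)`**, and `isZMonoprime_submonoid_primes_phiZero` (every prime component `≅ ℤ≥0`: Rmk. 3.3.1).

ROUTE (engines p432632, p433433): `Hom_G(S, DIV⁺)` is the invariant submonoid of `Maps(S, DIV⁺) ≅ ∏_{S × (Cusp ⊔ Comp)} ℤ≥0`
under the diagonal action `(g·f)(s) = g·f(g⁻¹ s)` (a subgroup of `Aut(∏ ℤ≥0)`, `PiNat.isPerfFactorialWeak_fixedPoints` …),
and `Hom_G(S, Div⁺) ⊆ Hom_G(S, DIV⁺)` is group-saturated (`Div` is a subgroup) and perf-dense (Prop. 3.2 (i), uniformly in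
`s`) — `GroupSaturatedSubmonoid.isPerfFactorialWeak` / `.rlfCofinal`.  HONEST FRAMING: weak reading of "perf-factorial"
(F-L2d2-1/F-L2d2-2; the printed reading fails as soon as `S × (Cusp ⊔ Comp)` has infinitely many `G`-orbits, cf.
`Sec3Prop34iDivPlusPrinted.lean`); the non-dilating and divisorial-on-`D₀` clauses and the passage to the inductive
LIMIT `Φ₀(Y^log)` are not treated here; `LogDivisorModel`/`GaloisAction` are interface/parameter records — nothing
asserts they arise from a curve; no side is taken on [IUTchIII] Cor. 3.12; typed ≠ proved for anything else.
-/

noncomputable section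

namespace Literature.AnabelianGeometry.EtaleTheta

open CategoryTheory Literature.AlgebraicGeometry.Frobenioids Function

universe u

namespace LogDivisorModel.GaloisAction

variable {Z : LogDivisorModel.{u}} {G : Type u} [Group G] (A : Z.GaloisAction G) (S : Action (Type u) G)

/-! ### The `G`-set structure maps -/

/-- `(g h) · s = g · (h · s)` for the structure action of the `G`-set `S`. [folklore] -/
private theorem ρ_mul_apply (g h : G) (s : S.V) : S.ρ (g * h) s = S.ρ g (S.ρ h s) := by
  rw [map_mul]; rfl

/-- `1 · s = s`. [folklore] -/
private theorem ρ_one_apply (s : S.V) : S.ρ (1 : G) s = s := by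
  rw [map_one]; rfl

/-- `g · (g⁻¹ · s) = s`. [folklore] -/
private theorem ρ_apply_inv_apply (g : G) (s : S.V) : S.ρ g (S.ρ g⁻¹ s) = s := by
  rw [← ρ_mul_apply, mul_inv_cancel, ρ_one_apply]

/-- `g⁻¹ · (g · s) = s`. [folklore] -/
private theorem ρ_inv_apply_apply (g : G) (s : S.V) : S.ρ g⁻¹ (S.ρ g s) = s := by
  rw [← ρ_mul_apply, inv_mul_cancel, ρ_one_apply]

/-! ### The diagonal action of `G` on `Maps(S, DIV⁺)` and its invariants `Hom_G(S, DIV⁺)` -/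

/-- **The diagonal action `(g·f)(s) = g·f(g⁻¹·s)` of `G` on `Maps(S, DIV⁺(Z^log_∞))` is by monoid automorphisms, and
its invariants are exactly the `G`-EQUIVARIANT maps.**  Stated as: there is a subgroup `Γ ≤ Aut(Maps(S, DIV⁺))` whose
fixed submonoid consists of the `f` with `f(g·s) = g·f(s)`. [cite: MochizukiEtTh2009, Def 3.3 p.73] -/
theorem exists_subgroup_fixedPoints_eq_equivariant :
    ∃ Γ : Subgroup (MulAut (S.V → ↥Z.DIVplus)), ∀ f : S.V → ↥Z.DIVplus,
      f ∈ FixedPoints.submonoid Γ (S.V → ↥Z.DIVplus) ↔ ∀ (g : G) (s : S.V), f (S.ρ g s) = A.actDIVplus g (f s) := by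
  -- the action of `g` on `DIV⁺`, as maps
  have hβmul : ∀ (g : G) (d d' : Z.DIVplus), A.actDIVplus g (d * d') = A.actDIVplus g d * A.actDIVplus g d' :=
    fun g d d' => Subtype.ext (by simp [coe_actDIVplus, map_mul])
  have hβcomp : ∀ (g h : G) (d : Z.DIVplus), A.actDIVplus (g * h) d = A.actDIVplus g (A.actDIVplus h d) :=
    fun g h d => Subtype.ext (by simp [coe_actDIVplus, map_mul, MulAut.mul_apply])
  have hβone : ∀ d : Z.DIVplus, A.actDIVplus 1 d = d := fun d => Subtype.ext (by simp [coe_actDIVplus])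
  have hβinv : ∀ (g : G) (d : Z.DIVplus), A.actDIVplus g (A.actDIVplus g⁻¹ d) = d := fun g d => by
    rw [← hβcomp, mul_inv_cancel, hβone]
  have hβinv' : ∀ (g : G) (d : Z.DIVplus), A.actDIVplus g⁻¹ (A.actDIVplus g d) = d := fun g d => by
    rw [← hβcomp, inv_mul_cancel, hβone]
  -- the automorphism `σ g` of `Maps(S, DIV⁺)`
  let σ : G → MulAut (S.V → ↥Z.DIVplus) := fun g =>
    { toFun := fun f s => A.actDIVplus g (f (S.ρ g⁻¹ s))
      invFun := fun f s => A.actDIVplus g⁻¹ (f (S.ρ g s))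
      left_inv := fun f => funext fun s => by
        simp only [hβinv', ρ_inv_apply_apply]
      right_inv := fun f => funext fun s => by
        simp only [hβinv, ρ_apply_inv_apply]
      map_mul' := fun f f' => funext fun s => by
        simp only [Pi.mul_apply, hβmul] }
  have hσ : ∀ (g : G) (f : S.V → ↥Z.DIVplus) (s : S.V), σ g f s = A.actDIVplus g (f (S.ρ g⁻¹ s)) :=
    fun _ _ _ => rfl
  let ρ : G →* MulAut (S.V → ↥Z.DIVplus) :=
    { toFun := σ
      map_one' := MulEquiv.ext fun f => funext fun s => by
        rw [hσ, MulAut.one_apply, inv_one, ρ_one_apply, hβone]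
      map_mul' := fun g h => MulEquiv.ext fun f => funext fun s => by
        rw [hσ, MulAut.mul_apply, hσ, hσ, hβcomp, mul_inv_rev, ρ_mul_apply] }
  refine ⟨ρ.range, fun f => ?_⟩
  rw [FixedPoints.mem_submonoid]
  constructor
  · intro h g s
    have hg : σ g f = f := h ⟨σ g, ⟨g, rfl⟩⟩
    have := congrFun hg (S.ρ g s)
    rw [hσ, ρ_inv_apply_apply] at this
    exact this.symm
  · rintro h ⟨γ, ⟨g, rfl⟩⟩
    change σ g f = f
    funext s
    rw [hσ, ← h g (S.ρ g⁻¹ s), ρ_apply_inv_apply]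

/-- `Maps(S, DIV⁺(Z^log_∞)) ≅ ∏_{S × (Cusp ⊔ Comp)} ℤ≥0` (Def. 3.1 (i), pointwise). [cite: MochizukiEtTh2009, Def 3.1 p.70] -/
theorem nonempty_maps_DIVplus_mulEquiv :
    Nonempty (Multiplicative (S.V × (Z.Cusp ⊕ Z.Comp) → ℕ) ≃* (S.V → ↥Z.DIVplus)) := by
  obtain ⟨e⟩ := Z.nonempty_piNatEquivDIVplus
  -- uncurry `Multiplicative (S × J → ℕ) ≃* (S → Multiplicative (J → ℕ))`, then `e` pointwise
  let u : Multiplicative (S.V × (Z.Cusp ⊕ Z.Comp) → ℕ) ≃* (S.V → Multiplicative (Z.Cusp ⊕ Z.Comp → ℕ)) :=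
    { toFun := fun f s => Multiplicative.ofAdd fun j => Multiplicative.toAdd f (s, j)
      invFun := fun f => Multiplicative.ofAdd fun p => Multiplicative.toAdd (f p.1) p.2
      left_inv := fun _ => rfl
      right_inv := fun _ => rfl
      map_mul' := fun _ _ => rfl }
  exact ⟨u.trans (MulEquiv.piCongrRight fun _ => e)⟩

/-! ### `Hom_G(S, DIV⁺)`: weakly perf-factorial, `ℤ`-monoprime components, cofinal perfection -/

section Equivariant

variable (Γ : Subgroup (MulAut (S.V → ↥Z.DIVplus)))

/-- The invariants of `Maps(S, DIV⁺)` under ANY `Γ ≤ Aut` transport to invariants of `∏_{S × (Cusp ⊔ Comp)} ℤ≥0`.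
[cite: MochizukiEtTh2009, Def 3.1 p.70] -/
theorem exists_fixedPoints_maps_congr :
    ∃ Γ₀ : Subgroup (MulAut (Multiplicative (S.V × (Z.Cusp ⊕ Z.Comp) → ℕ))),
      Nonempty (↥(FixedPoints.submonoid Γ (S.V → ↥Z.DIVplus)) ≃*
        ↥(FixedPoints.submonoid Γ₀ (Multiplicative (S.V × (Z.Cusp ⊕ Z.Comp) → ℕ)))) := by
  obtain ⟨e⟩ := nonempty_maps_DIVplus_mulEquiv (Z := Z) S
  exact exists_fixedPoints_congr e Γ

/-- The `Γ`-invariants of `Maps(S, DIV⁺)` are weakly perf-factorial. [cite: MochizukiEtTh2009, Prop 3.4 p.74] -/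
theorem isPerfFactorialWeak_fixedPoints_maps : IsPerfFactorialWeak ↥(FixedPoints.submonoid Γ (S.V → ↥Z.DIVplus)) := by
  obtain ⟨Γ₀, ⟨e⟩⟩ := exists_fixedPoints_maps_congr (Z := Z) S Γ
  exact (PiNat.isPerfFactorialWeak_fixedPoints Γ₀).of_mulEquiv e.symm

/-- … with `ℤ`-monoprime prime components (primes = `Γ`-orbits, Rmk. 3.3.1). [cite: MochizukiEtTh2009, Rmk 3.3.1 p.73] -/
theorem isZMonoprime_submonoid_primes_fixedPoints_maps (𝔭 : Primes ↥(FixedPoints.submonoid Γ (S.V → ↥Z.DIVplus))) :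
    IsZMonoprime ↥𝔭.submonoid := by
  obtain ⟨Γ₀, ⟨e⟩⟩ := exists_fixedPoints_maps_congr (Z := Z) S Γ
  exact (PiNat.isZMonoprime_submonoid_primes_fixedPoints Γ₀ (Primes.congr e 𝔭)).of_mulEquiv
    (Primes.submonoidCongr e.symm (Primes.congr e 𝔭) 𝔭 (Primes.congr_symm_apply_congr e 𝔭))

/-- … and with cofinal perfection. [cite: MochizukiEtTh2009, Lem 3.5 p.75] -/
theorem rlfCofinal_fixedPoints_maps :
    ∀ x : (isPerfFactorialWeak_fixedPoints_maps (Z := Z) S Γ).Rlf, ∃ b,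
      x ∣ (isPerfFactorialWeak_fixedPoints_maps (Z := Z) S Γ).toRealification b := by
  obtain ⟨Γ₀, ⟨e⟩⟩ := exists_fixedPoints_maps_congr (Z := Z) S Γ
  exact IsPerfFactorialWeak.rlfCofinal_of_mulEquiv e.symm (PiNat.isPerfFactorialWeak_fixedPoints Γ₀)
    (PiNat.rlfCofinal_fixedPoints Γ₀) (isPerfFactorialWeak_fixedPoints_maps (Z := Z) S Γ)

/-- The maps with CARTIER effective values inside the `Γ`-invariants: group-saturated (pointwise, `Div` a subgroup).
[cite: MochizukiEtTh2009, Def 3.1 p.70] -/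
theorem isGroupSaturated_cartier_fixedPoints_maps :
    IsGroupSaturated ((Submonoid.pi Set.univ fun _ : S.V => Z.Divplus.comap Z.DIVplus.subtype).comap
      (FixedPoints.submonoid Γ (S.V → ↥Z.DIVplus)).subtype) := by
  rw [isGroupSaturated_iff']
  intro q a ha b hb h
  rw [Submonoid.mem_comap, Submonoid.mem_pi] at ha hb ⊢
  intro s _
  have hs : (q : S.V → ↥Z.DIVplus) s * (b : S.V → ↥Z.DIVplus) s = (a : S.V → ↥Z.DIVplus) s := by
    have := congrArg (fun f : ↥(FixedPoints.submonoid Γ (S.V → ↥Z.DIVplus)) => (f : S.V → ↥Z.DIVplus) s) h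
    simpa using this
  exact (isGroupSaturated_iff' _).mp Z.isGroupSaturated_Divplus_comap _ _ (ha s (Set.mem_univ _)) _
    (hb s (Set.mem_univ _)) hs

/-- … and perf-dense (Prop. 3.2 (i): ONE `n` with `n · DIV⁺ ⊆ Div⁺`, applied pointwise). [cite: MochizukiEtTh2009, Prop 3.2 p.70] -/
theorem mem_perfSaturation_cartier_fixedPoints_maps (x : ↥(FixedPoints.submonoid Γ (S.V → ↥Z.DIVplus))) :
    x ∈ perfSaturation ((Submonoid.pi Set.univ fun _ : S.V => Z.Divplus.comap Z.DIVplus.subtype).comap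
      (FixedPoints.submonoid Γ (S.V → ↥Z.DIVplus)).subtype) := by
  obtain ⟨n, hn⟩ := Z.exists_pow_mem_Divplus
  rw [mem_perfSaturation_iff]
  refine ⟨n, ?_⟩
  rw [Submonoid.mem_comap, Submonoid.mem_pi]
  intro s _
  have hx : ((((x : S.V → ↥Z.DIVplus) s : ↥Z.DIVplus) : Z.DIV)) ^ (n : ℕ) ∈ Z.Divplus :=
    hn _ ((x : S.V → ↥Z.DIVplus) s).2
  simpa [Submonoid.mem_comap, SubmonoidClass.coe_pow, Pi.pow_apply] using hx

/-- The maps with Cartier effective values, `Γ`-invariant, form a weakly perf-factorial monoid with cofinal perfection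
and `ℤ`-monoprime components (engine `GroupSaturatedSubmonoid`). [cite: MochizukiEtTh2009, Prop 3.4 p.74] -/
theorem isPerfFactorialCof_cartier_fixedPoints_maps :
    IsPerfFactorialCof ↥((Submonoid.pi Set.univ fun _ : S.V => Z.Divplus.comap Z.DIVplus.subtype).comap
      (FixedPoints.submonoid Γ (S.V → ↥Z.DIVplus)).subtype) :=
  have hM := GroupSaturatedSubmonoid.isPerfFactorialWeak (isPerfFactorialWeak_fixedPoints_maps (Z := Z) S Γ)
    (isZMonoprime_submonoid_primes_fixedPoints_maps (Z := Z) S Γ) (isGroupSaturated_cartier_fixedPoints_maps (Z := Z) S Γ)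
    (mem_perfSaturation_cartier_fixedPoints_maps (Z := Z) S Γ)
  ⟨hM, GroupSaturatedSubmonoid.rlfCofinal (isPerfFactorialWeak_fixedPoints_maps (Z := Z) S Γ)
    (rlfCofinal_fixedPoints_maps (Z := Z) S Γ) (mem_perfSaturation_cartier_fixedPoints_maps (Z := Z) S Γ) hM⟩

end Equivariant

/-! ### `Φ₀(S) = Hom_G(S, Div⁺(Z^log_∞))` -/

/-- **`Φ₀(S) = Hom_G(S, Div⁺)` is isomorphic to the monoid of `G`-equivariant maps `S → DIV⁺` with Cartier values** (the
values of `φ ∈ Φ₀(S)` are effective, so `φ` factors through `DIV⁺`). [cite: MochizukiEtTh2009, Def 3.3 p.73] -/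
theorem exists_phiZero_mulEquiv :
    ∃ Γ : Subgroup (MulAut (S.V → ↥Z.DIVplus)),
      Nonempty (↥((Submonoid.pi Set.univ fun _ : S.V => Z.Divplus.comap Z.DIVplus.subtype).comap
        (FixedPoints.submonoid Γ (S.V → ↥Z.DIVplus)).subtype) ≃* ↥(A.phiZero S)) := by
  obtain ⟨Γ, hΓ⟩ := exists_subgroup_fixedPoints_eq_equivariant A S
  -- into `Φ₀(S)`: Cartier values and equivariance
  have hto : ∀ x : ↥((Submonoid.pi Set.univ fun _ : S.V => Z.Divplus.comap Z.DIVplus.subtype).comap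
      (FixedPoints.submonoid Γ (S.V → ↥Z.DIVplus)).subtype),
      (fun s => ((x.1.1 s : ↥Z.DIVplus) : Z.DIV)) ∈ A.phiZero S := by
    intro x
    refine (A.mem_phiZero_iff S _).mpr ⟨fun s => ?_, fun g s => ?_⟩
    · have hx := x.2
      rw [Submonoid.mem_comap, Submonoid.mem_pi] at hx
      exact hx s (Set.mem_univ _)
    · have hf := (hΓ _).mp x.1.2 g s
      exact (congrArg (fun d : ↥Z.DIVplus => (d : Z.DIV)) hf).trans (A.coe_actDIVplus g _)
  -- from `Φ₀(S)`: equivariant, with Cartier values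
  have hfix : ∀ φ : ↥(A.phiZero S),
      (fun s => (⟨φ.1 s, Z.Divplus_le_DIVplus (((A.mem_phiZero_iff S φ.1).mp φ.2).1 s)⟩ : ↥Z.DIVplus)) ∈
        FixedPoints.submonoid Γ (S.V → ↥Z.DIVplus) := by
    intro φ
    rw [hΓ]
    intro g s
    exact Subtype.ext (by simpa [coe_actDIVplus] using ((A.mem_phiZero_iff S φ.1).mp φ.2).2 g s)
  have hcart : ∀ φ : ↥(A.phiZero S),
      (⟨_, hfix φ⟩ : ↥(FixedPoints.submonoid Γ (S.V → ↥Z.DIVplus))) ∈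
        (Submonoid.pi Set.univ fun _ : S.V => Z.Divplus.comap Z.DIVplus.subtype).comap
          (FixedPoints.submonoid Γ (S.V → ↥Z.DIVplus)).subtype := by
    intro φ
    rw [Submonoid.mem_comap, Submonoid.mem_pi]
    intro s _
    exact ((A.mem_phiZero_iff S φ.1).mp φ.2).1 s
  exact ⟨Γ, ⟨{ toFun := fun x => ⟨_, hto x⟩,
               invFun := fun φ => ⟨⟨_, hfix φ⟩, hcart φ⟩,
               left_inv := fun _ => rfl,
               right_inv := fun _ => rfl,
               map_mul' := fun _ _ => rfl }⟩⟩

/-- **[EtTh] Prop. 3.4 (i) at the constructed Def. 3.3 (iii) pieces**: `Φ₀(S) = Hom_G(S, Div⁺(Z^log_∞))` is weakly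
perf-factorial WITH COFINAL PERFECTION, for every `LogDivisorModel` `Z`, every Galois-action record `A : Z.GaloisAction G`
and every `G`-set `S` ("each of the monoids `Div⁺(Z^log_∞)^{Gal(Z^log_∞/Y^log)}` … is perf-factorial … follows
immediately from Proposition 3.2, (i)"). [cite: MochizukiEtTh2009, Prop 3.4 p.74] -/
theorem isPerfFactorialCof_phiZero : IsPerfFactorialCof ↥(A.phiZero S) := by
  obtain ⟨Γ, ⟨e⟩⟩ := exists_phiZero_mulEquiv A S
  obtain ⟨hM, hcof⟩ := isPerfFactorialCof_cartier_fixedPoints_maps (Z := Z) S Γ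
  exact ⟨hM.of_mulEquiv e, IsPerfFactorialWeak.rlfCofinal_of_mulEquiv e hM hcof (hM.of_mulEquiv e)⟩

/-- **Every prime component `Φ₀(S)_𝔭 ≅ ℤ≥0`** (Rmk. 3.3.1: primes of `Div⁺(Z^log_∞)^{Gal}` ↔ Galois orbits of prime
log-divisors). [cite: MochizukiEtTh2009, Rmk 3.3.1 p.73] -/
theorem isZMonoprime_submonoid_primes_phiZero (𝔭 : Primes ↥(A.phiZero S)) : IsZMonoprime ↥𝔭.submonoid := by
  obtain ⟨Γ, ⟨e⟩⟩ := exists_phiZero_mulEquiv A S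
  exact (GroupSaturatedSubmonoid.isZMonoprime_submonoid_primes
      (isPerfFactorialWeak_fixedPoints_maps (Z := Z) S Γ).isDivisorial.isSharp
      (isZMonoprime_submonoid_primes_fixedPoints_maps (Z := Z) S Γ) (isGroupSaturated_cartier_fixedPoints_maps (Z := Z) S Γ)
      (mem_perfSaturation_cartier_fixedPoints_maps (Z := Z) S Γ) (Primes.congr e.symm 𝔭)).of_mulEquiv
    (Primes.submonoidCongr e (Primes.congr e.symm 𝔭) 𝔭 (Primes.congr_apply_congr_symm e 𝔭))

/-- **[EtTh] Prop. 3.4 (i), first clause, IN THE WEAK VOCABULARY OF RECORD at the constructed `Φ₀`-pieces**: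
`treeMonoidVocabWeak.IsPerfFactorial (Φ₀(S))` for every `G`-set `S` — the conjunct
`∀ Y, V.IsPerfFactorial ((ofGaloisAction A hZ).Φ₀.obj Y)` of abc-iut-w6-d058's `prop34_ofGaloisAction_iff` at
`V := treeMonoidVocabWeak` (their `Φ₀.obj Y` is `A.phiZero Y.unop` by `PhiZero_obj`).
[cite: MochizukiEtTh2009, Prop 3.4 p.74] -/
theorem prop34_i_phiZero : treeMonoidVocabWeak.IsPerfFactorial ↥(A.phiZero S) :=
  (treeMonoidVocabWeak_isPerfFactorial _).mpr (isPerfFactorialCof_phiZero A S)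

end LogDivisorModel.GaloisAction

end Literature.AnabelianGeometry.EtaleTheta

end
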